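import Literature.NumberTheory.DiophantineGeometry.PlaneCurveFiniteFibres
import Mathlib.FieldTheory.IsAlgClosed.Basic

/-!
# The projection of `V(f, G)` is the zero set of the resultant (support lemma for [GenEll] Thm 2.1)

Companion of `PlaneCurveFiniteFibres.lean`.  For a field `K`, `f, G ∈ K[x][Y]` with `f` MONIC of
positive degree in `Y`, and an ALGEBRAICALLY CLOSED field `Ω ⊇ K`:

* `exists_common_zero_of_aeval_resultant_eq_zero` — if `Res_Y(f, G)(a) = 0` then `f(a, ·)` and
  `G(a, ·)` have a common root `b ∈ Ω` (the resultant of the specialised polynomials vanishes: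
  monicity of `f` makes the formal-degree padding harmless, Mathlib `resultant_add_right_deg`; a
  vanishing resultant over a field means «not coprime», `resultant_eq_zero_iff`, and over an
  algebraically closed field «not coprime» means «common root»,
  `isCoprime_iff_aeval_ne_zero_of_isAlgClosed`);
* `aeval_resultant_eq_zero_iff` — `Res_Y(f, G)(a) = 0 ↔ ∃ b, f(a,b) = 0 ∧ G(a,b) = 0`;
* `setOf_aeval_resultant_eq_zero` — `{a : Res(a) = 0} = x-projection of V(f, G)(Ω)`.

So the `x`-projection of `V(f, G)` is the root set of ONE polynomial `Res_Y(f,G) ∈ K[x]` (nonzero as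
soon as `f, G` are coprime in `K(x)[Y]`, `resultant_ne_zero_of_isCoprime_map`), SIMULTANEOUSLY in every
algebraically closed `Ω ⊇ K` (e.g. `ℂ` and `ℚ̄_2`).  Use (abc-iut cell, GenEllTwo = stmt-ABC-19679,
S6 ruling #6): the finite sets `X_T = x(t_c⁻¹(B))` of the per-configuration protection enter the
spine `vojtaIneq_univ_of_persistent` as `g.aroots ℂ`, `g.aroots (PadicAlgCl 2)` for ONE
`g ∈ ℚ[X]` — `g` is this resultant (`GenEllDeFibresPolynomial.lean`).  Classical elimination
(Bombieri–Gubler B.1.8: for a field, `res(f,g) ≠ 0` iff `f, g` have no common root in an algebraic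
closure); nothing here bears on any disputed claim.
-/

namespace Literature.NumberTheory.DiophantineGeometry.PlaneCurve

open Polynomial

universe u v

variable {K : Type u} [Field K] {Ω : Type v} [Field Ω] [Algebra K Ω]

/-- Specialising the coefficient variable: the resultant of `f(a, ·), G(a, ·)` computed with the
ORIGINAL formal degrees is the specialisation of `Res_Y(f, G)`. (Mathlib `resultant_map_map`.)
[cite: BombieriGubler2006, B.1.12 (resultants commute with ring homomorphisms)] -/
theorem resultant_map_aeval (f G : K[X][X]) (a : Ω) :
    resultant (f.map (aeval a).toRingHom) (G.map (aeval a).toRingHom) f.natDegree G.natDegree =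
      aeval a (resultant f G) := by
  rw [resultant_map_map]
  rfl

/-- For `f` monic, the resultant of the specialisations with the original formal degrees equals
their resultant with their ACTUAL degrees (the `Y`-degree of `G` may drop at `x = a`; monicity of
`f` makes the padding factor `lc(f(a,·))^k = 1`). [cite: BombieriGubler2006, B.1.8 with B.1.12 (resultant, monic case)] -/
theorem resultant_specialise_eq (f G : K[X][X]) (hf : f.Monic) (a : Ω) :
    resultant (f.map (aeval a).toRingHom) (G.map (aeval a).toRingHom) f.natDegree G.natDegree =
      resultant (f.map (aeval a).toRingHom) (G.map (aeval a).toRingHom) := by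
  set fa := f.map (aeval a).toRingHom with hfa
  set Ga := G.map (aeval a).toRingHom with hGa
  have hfdeg : fa.natDegree = f.natDegree := hf.natDegree_map _
  have hGle : Ga.natDegree ≤ G.natDegree := natDegree_map_le
  obtain ⟨k, hk⟩ := Nat.exists_eq_add_of_le hGle
  rw [← hfdeg, hk, resultant_add_right_deg _ _ _ _ k le_rfl]
  have hlc : fa.coeff fa.natDegree = 1 := (hf.map _).leadingCoeff
  rw [hlc, one_pow, one_mul]

/-- **A vanishing resultant gives a common zero** (over an algebraically closed field).  If
`f ∈ K[x][Y]` is monic and `Res_Y(f, G)` vanishes at `a ∈ Ω`, `Ω ⊇ K`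
algebraically closed, then `f(a, b) = G(a, b) = 0` for some `b ∈ Ω`.
[cite: BombieriGubler2006, B.1.8 (res(f,g) = 0 iff a common root in an algebraic closure)] -/
theorem exists_common_zero_of_aeval_resultant_eq_zero [IsAlgClosed Ω] (f G : K[X][X]) (hf : f.Monic)
    (a : Ω) (ha : aeval a (resultant f G) = 0) :
    ∃ b : Ω, (f.map (aeval a).toRingHom).eval b = 0 ∧ (G.map (aeval a).toRingHom).eval b = 0 := by
  set fa := f.map (aeval a).toRingHom with hfa
  set Ga := G.map (aeval a).toRingHom with hGa
  have hres : resultant fa Ga = 0 := by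
    rw [← resultant_specialise_eq f G hf a, resultant_map_aeval, ha]
  have hfa0 : fa ≠ 0 := (hf.map _).ne_zero
  have hnc : ¬ IsCoprime fa Ga := (resultant_eq_zero_iff.mp hres).2
  rw [Polynomial.isCoprime_iff_aeval_ne_zero_of_isAlgClosed Ω Ω fa Ga] at hnc
  push Not at hnc
  obtain ⟨b, hb1, hb2⟩ := hnc
  refine ⟨b, ?_, ?_⟩
  · simpa [coe_aeval_eq_eval] using hb1
  · simpa [coe_aeval_eq_eval] using hb2

/-- **`Res_Y(f,G)(a) = 0 ↔ f(a,·), G(a,·) have a common root`**, for `f` monic of positive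
`Y`-degree and `Ω ⊇ K` algebraically closed. [cite: BombieriGubler2006, B.1.8 (resultant and common roots)] -/
theorem aeval_resultant_eq_zero_iff [IsAlgClosed Ω] (f G : K[X][X]) (hf : f.Monic)
    (hdeg : f.natDegree ≠ 0) (a : Ω) :
    aeval a (resultant f G) = 0 ↔
      ∃ b : Ω, (f.map (aeval a).toRingHom).eval b = 0 ∧ (G.map (aeval a).toRingHom).eval b = 0 :=
  ⟨exists_common_zero_of_aeval_resultant_eq_zero f G hf a,
    fun ⟨b, hfb, hGb⟩ => aeval_resultant_eq_zero_of_common_zero f G hdeg a b hfb hGb⟩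

/-- **The `x`-projection of `V(f, G)(Ω)` is the zero set of `Res_Y(f, G)`** (`f` monic of positive
`Y`-degree, `Ω ⊇ K` algebraically closed): one polynomial in `K[x]`, the same for every such `Ω`.
[cite: BombieriGubler2006, B.1.8 (resultant and common roots)] -/
theorem setOf_aeval_resultant_eq_zero [IsAlgClosed Ω] (f G : K[X][X]) (hf : f.Monic)
    (hdeg : f.natDegree ≠ 0) :
    {a : Ω | aeval a (resultant f G) = 0} =
      Prod.fst '' {z : Ω × Ω | (f.map (aeval z.1).toRingHom).eval z.2 = 0 ∧
        (G.map (aeval z.1).toRingHom).eval z.2 = 0} := by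
  ext a
  simp only [Set.mem_setOf_eq, Set.mem_image, Prod.exists, exists_and_right, exists_eq_right]
  rw [aeval_resultant_eq_zero_iff f G hf hdeg a]

/-- **Root-set form**: if moreover `f, G` are coprime in `K(x)[Y]` (so `Res ≠ 0`), the `x`-projection
of `V(f, G)(Ω)` is the FINITE root set `(Res_Y(f,G)).rootSet Ω`.
[cite: BombieriGubler2006, B.1.8 (resultant and common roots)] -/
theorem rootSet_resultant_eq [IsAlgClosed Ω] (f G : K[X][X]) (hf : f.Monic) (hdeg : f.natDegree ≠ 0)
    (hcop : IsCoprime (f.map (algebraMap K[X] (RatFunc K))) (G.map (algebraMap K[X] (RatFunc K)))) :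
    (resultant f G).rootSet Ω =
      Prod.fst '' {z : Ω × Ω | (f.map (aeval z.1).toRingHom).eval z.2 = 0 ∧
        (G.map (aeval z.1).toRingHom).eval z.2 = 0} := by
  rw [← setOf_aeval_resultant_eq_zero f G hf hdeg]
  ext a
  rw [Polynomial.mem_rootSet, Set.mem_setOf_eq]
  exact ⟨fun h => h.2, fun h => ⟨resultant_ne_zero_of_isCoprime_map f G hf hcop, h⟩⟩

end Literature.NumberTheory.DiophantineGeometry.PlaneCurve
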